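import Summits.Ventures.HodgeRepro.FaceLatticeCore

/-!
# The `(C₁₀, 5)` witness of ROUTE.md §3.6(iii): semigroup-indecomposable, lattice-decomposable — kernel-checked

Blind re-derivation cell `pub-hodge-repro`, seat `night-3`.  Mathlib + typer-2's `FaceLatticeCore` only.
Namespace `HodgeRepro.Night3.Witness`.

ROUTE.md §3.6(iii) exhibits a zero-sum multiset of six CM types of a degree-10 field (m = 5 places) with no conjugate
pair and no zero-sum proper sub-multiset — «no p = 2 mechanism reaches it».  ERRATUM F1 (ref-2, INBOX L1039) and the
lead's Lemma L (route/lattice-lead-g18/LEMMA-L-P-v2.md, «EXPLICIT IDENTITY»; witness10.py) answer: the multiset PLUS ONE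
conjugate pair equals the sum of TWO census faces, so the lattice generated by pairs and faces contains it although the
semigroup does not.  With sign vectors over the places `0 … 4` (`true` = the fixed embedding of the place lies in the
type): M = {−−−−−, −−−−+, −+++−, +−++−, ++−++, +++−+}, the pair {++−−+, −−++−}, the faces
(−−−−−; 3, 2) = {−−−−−, +++−+, ++−++, −−++−} and (++−−+; 0, 1) = {++−−+, +−++−, −+++−, −−−−+}.  Kernel facts on
`FaceLatticeCore`'s vectors: `c10_zeroSum` (the witness is zero-sum), `c10_indecomposable` (no proper non-empty
sub-family of the six — sub-families indexed by the 64 bitmasks — is zero-sum; in particular no conjugate pair, no face),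
`c10_add_pair_eq_two_faces` (the identity).  Nothing here closes anything; no sealed file is touched; no Tier-2 item depends
on this file.
-/

set_option autoImplicit false

namespace HodgeRepro.Night3.Witness

open HodgeRepro.FaceLattice

/-- The six types of the witness, as sign vectors over the places `0 … 4`. -/
def c10 : Fin 6 → CMType 5
  | 0 => ![false, false, false, false, false]
  | 1 => ![false, false, false, false, true]
  | 2 => ![false, true, true, true, false]
  | 3 => ![true, false, true, true, false]
  | 4 => ![true, true, false, true, true]
  | 5 => ![true, true, true, false, true]

/-- The type `++−−+` of the conjugate pair added to the witness. -/
def pairType : CMType 5 := ![true, true, false, false, true]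

/-- The count vector of the witness multiset. -/
def c10Vec : CMType 5 → ℤ := ∑ k, e (c10 k)

/-- The count vector of the sub-family of the witness selected by the bits of `s` (`s = 63` is the whole witness). -/
def subVec (s : Fin 64) : CMType 5 → ℤ := ∑ k : Fin 6, if s.val.testBit k.val then e (c10 k) else 0

/-- The weight of the witness at a place is the sum of the six signs there. -/
theorem weight_c10Vec (i : Fin 5) : weight i c10Vec = ∑ k : Fin 6, sgn (c10 k i) := by
  simp only [c10Vec, map_sum, weight_e]

/-- The weight of a sub-family at a place is the sum of its signs there. -/
theorem weight_subVec (s : Fin 64) (i : Fin 5) :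
    weight i (subVec s) = ∑ k : Fin 6, if s.val.testBit k.val then sgn (c10 k i) else 0 := by
  simp only [subVec, map_sum]
  refine Finset.sum_congr rfl fun k _ => ?_
  split_ifs <;> simp [weight_e]

/-- The six signs of the witness sum to `0` at every place (every place lies in exactly three of the six types). -/
theorem c10_signs : ∀ i : Fin 5, ∑ k : Fin 6, sgn (c10 k i) = 0 := by decide +kernel

/-- The witness is zero-sum. -/
theorem c10_zeroSum : c10Vec ∈ zeroSum 5 := by
  rw [mem_zeroSum]; intro i; rw [weight_c10Vec]; exact c10_signs i

/-- No proper non-empty sub-family of the six has all its sign sums zero. -/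
theorem c10_signs_sub : ∀ s : Fin 64, s ≠ 0 → s ≠ 63 →
    ∃ i : Fin 5, (∑ k : Fin 6, if s.val.testBit k.val then sgn (c10 k i) else 0) ≠ 0 := by
  decide +kernel

/-- The witness is SEMIGROUP-INDECOMPOSABLE: no proper non-empty sub-family is zero-sum (so it contains no conjugate
pair and no face) — the «level ≥ 3» of ROUTE.md §3.6(iii). -/
theorem c10_indecomposable : ∀ s : Fin 64, s ≠ 0 → s ≠ 63 → subVec s ∉ zeroSum 5 := by
  intro s h0 h63 hmem
  rw [mem_zeroSum] at hmem
  obtain ⟨i, hi⟩ := c10_signs_sub s h0 h63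
  exact hi (by rw [← weight_subVec]; exact hmem i)

/-- The corners of the face `(−−−−−; 3, 2)` are the witness types `+++−+`, `++−++` and the pair type's conjugate `−−++−`. -/
theorem corners_face_A :
    FaceLattice.flip 3 (conj (c10 0)) = c10 5 ∧ FaceLattice.flip 2 (conj (c10 0)) = c10 4 ∧
      FaceLattice.flip 2 (FaceLattice.flip 3 (c10 0)) = conj pairType := by
  decide +kernel

/-- The corners of the face `(++−−+; 0, 1)` are the witness types `+−++−`, `−+++−`, `−−−−+`. -/
theorem corners_face_B :
    FaceLattice.flip 0 (conj pairType) = c10 3 ∧ FaceLattice.flip 1 (conj pairType) = c10 2 ∧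
      FaceLattice.flip 1 (FaceLattice.flip 0 pairType) = c10 1 := by
  decide +kernel

/-- **The witness is LATTICE-DECOMPOSABLE**: the witness plus the conjugate pair {++−−+, −−++−} equals the sum of the two
census faces (−−−−−; 3, 2) and (++−−+; 0, 1) — LEMMA-L-P-v2.md's explicit identity, kernel-checked. -/
theorem c10_add_pair_eq_two_faces :
    c10Vec + pairVec pairType = faceVec (c10 0) 3 2 + faceVec pairType 0 1 := by
  obtain ⟨hA1, hA2, hA3⟩ := corners_face_A
  obtain ⟨hB1, hB2, hB3⟩ := corners_face_B
  rw [faceVec, faceVec, hA1, hA2, hA3, hB1, hB2, hB3, pairVec, c10Vec, Fin.sum_univ_six]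
  abel

end HodgeRepro.Night3.Witness
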